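import Literature.Combinatorics.AssociationSchemes.SliceLevelInequality
import HarnessLib

/-!
# Level-`k` inequalities on a slice of the cube — wider balance `n ≤ 5t`

Companion to `Literature/Combinatorics/AssociationSchemes/SliceLevelInequality.lean` (§6–§7 there give the
absolute-constant level-`j` inequality `W_j[f] ≤ 16 μ² (48e(2 ln(1/μ)/j + 3))^j` on BALANCED slices `64 ≤ n ≤ 4t`,
`2t ≤ n`, `8j ≤ n`). This file proves the SAME bound under the wider balance `100 ≤ n ≤ 5t`, `2t ≤ n`, `16j ≤ n`:
`slice_level_sq_le_log_balanced'`, `slice_layer_sq_le_log_balanced'`, via `transferLambda_le'`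
(`Λ ≤ 16·48^j·C(n,t)`): the binomial window `n/2 ≤ s ≤ 3n/5` still carries a quarter of the mass for `n ≥ 100`
(Chebyshev, `two_pow_le_four_mul_sum_choose_window'`), each of its levels contributes
`C(n−t−j, s−t)/C(s,t) ≥ 3^{−j} C(n,s)/C(n,t)` once `t ≥ n/5` and `16j ≤ n` (`choose_le_transferCoeff_mul'`), and
`C(n,t)/C(n−2j,t−j) ≤ (64/3)^j` under the same hypotheses (`three_pow_mul_choose_le'`). The proofs are those of §6
verbatim with the window and the two linear side conditions changed.

Consumer: cell pnp-psdrank (summit PneNP, route `ChebyshevTracialDesign`), step S6 of the `r = 1` rung — the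
spectral non-tightness lemma is applied in REDUCED instances `K_{n''}` whose cut size is balanced only up to an
additive `O(n^{1/4})`, so `n'' ≤ 4t''` may fail while `n'' ≤ 5t''` holds. Everything is proved; no definitions, no
named facts. Label: support / instrument. WHAT THIS IS NOT: nothing about psd rank or P vs NP.

## References
* [ODonnell2014] R. O'Donnell, *Analysis of Boolean Functions*, CUP 2014, §9.5 (level-k inequalities) and §1.4.
-/

noncomputable section

open Finset
open scoped BigOperators

namespace Literature.Combinatorics.AssociationSchemes

namespace SliceLevelInequality

open JohnsonHarmonics JohnsonSpectrum

variable {n : ℕ}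

/-! ### §1 Wider balance `n ≤ 5t`

The consumer (the `r = 1` rung of route `ChebyshevTracialDesign`) applies the level-`j` inequality in REDUCED
instances `K_{n''}` whose cut size is balanced only up to an additive `O(n^{1/4})`, so `n'' ≤ 4t''` may fail while
`n'' ≤ 5t''` holds. The constants of §6 survive: the binomial window `n/2 ≤ s ≤ 3n/5` still carries a quarter of
the mass once `n ≥ 100` (Chebyshev), each of its levels contributes `C(n−t−j, s−t)/C(s,t) ≥ 3^{−j} C(n,s)/C(n,t)`
as soon as `t ≥ n/5` and `16j ≤ n`, and `C(n,t)/C(n−2j,t−j) ≤ (64/3)^j` under the same hypotheses. -/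

/-- The binomial tail beyond `3n/5` is small: `n² Σ_{5s > 3n} C(n,s) ≤ 25 n 2^n` (Chebyshev).
[cite: ODonnell2014, §1.4] -/
theorem sq_mul_sum_choose_tail_le' (n : ℕ) :
    (n : ℝ) ^ 2 * ∑ s ∈ range (n + 1), (if 3 * n < 5 * s then ((n.choose s : ℕ) : ℝ) else 0) ≤ 25 * ((n : ℝ) * 2 ^ n) := by
  rw [← sum_choose_mul_sq n, mul_sum, mul_sum]
  refine sum_le_sum fun s _ => ?_
  split_ifs with h
  · have h' : (3 : ℝ) * n < 5 * s := by exact_mod_cast h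
    have hsq : (n : ℝ) ^ 2 ≤ 25 * ((n : ℝ) - 2 * s) ^ 2 := by nlinarith
    calc (n : ℝ) ^ 2 * ((n.choose s : ℕ) : ℝ) ≤ 25 * ((n : ℝ) - 2 * s) ^ 2 * ((n.choose s : ℕ) : ℝ) :=
          mul_le_mul_of_nonneg_right hsq (Nat.cast_nonneg _)
      _ = 25 * (((n.choose s : ℕ) : ℝ) * ((n : ℝ) - 2 * s) ^ 2) := by ring
  · rw [mul_zero]; positivity

/-- **The binomial window** `n/2 ≤ s ≤ 3n/5` carries a quarter of the mass for `n ≥ 100`: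
`2^n ≤ 4 Σ_{n ≤ 2s, 5s ≤ 3n} C(n,s)`. [cite: ODonnell2014, §1.4] -/
theorem two_pow_le_four_mul_sum_choose_window' {n : ℕ} (hn : 100 ≤ n) :
    (2 : ℝ) ^ n ≤ 4 * ∑ s ∈ range (n + 1),
      (if n ≤ 2 * s ∧ 5 * s ≤ 3 * n then ((n.choose s : ℕ) : ℝ) else 0) := by
  have hup := two_pow_le_two_mul_sum_choose_upper n
  have htail := sq_mul_sum_choose_tail_le' n
  have hn0 : (100 : ℝ) ≤ n := by exact_mod_cast hn
  have hsplit : ∑ s ∈ range (n + 1), (if n ≤ 2 * s then ((n.choose s : ℕ) : ℝ) else 0) ≤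
      ∑ s ∈ range (n + 1), (if n ≤ 2 * s ∧ 5 * s ≤ 3 * n then ((n.choose s : ℕ) : ℝ) else 0) +
        ∑ s ∈ range (n + 1), (if 3 * n < 5 * s then ((n.choose s : ℕ) : ℝ) else 0) := by
    rw [← sum_add_distrib]
    refine sum_le_sum fun s _ => ?_
    by_cases h1 : n ≤ 2 * s
    · by_cases h2 : 5 * s ≤ 3 * n
      · rw [if_pos h1, if_pos ⟨h1, h2⟩, if_neg (not_lt.2 h2), add_zero]
      · rw [if_pos h1, if_neg (fun h => h2 h.2), if_pos (not_le.1 h2), zero_add]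
    · rw [if_neg h1]; split_ifs <;> positivity
  have htail' : ∑ s ∈ range (n + 1), (if 3 * n < 5 * s then ((n.choose s : ℕ) : ℝ) else 0) ≤ 2 ^ n / 4 := by
    have hn2 : (0 : ℝ) < (n : ℝ) ^ 2 := by positivity
    rw [le_div_iff₀ (by norm_num : (0 : ℝ) < 4)]
    have h100 : 100 * (n : ℝ) ≤ (n : ℝ) ^ 2 := by nlinarith
    nlinarith [sum_nonneg (fun s (_ : s ∈ range (n + 1)) =>
      (show (0 : ℝ) ≤ (if 3 * n < 5 * s then ((n.choose s : ℕ) : ℝ) else 0) by split_ifs <;> positivity)),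
      pow_pos (show (0:ℝ) < 2 by norm_num) n]
  linarith

/-- **Each window level contributes** (wide balance): for `t ≤ s ≤ n` with `5s ≤ 3n`, `n ≤ 5t` and `16j ≤ n`,
`C(n, s) ≤ 3^j · C(n,t) · transferCoeff n t j s`. [cite: ODonnell2014, §9.5] -/
theorem choose_le_transferCoeff_mul' {t j s : ℕ} (hts : t ≤ s) (hsn : s ≤ n) (hs : 5 * s ≤ 3 * n)
    (hbal : n ≤ 5 * t) (hj : 16 * j ≤ n) :
    ((n.choose s : ℕ) : ℝ) ≤ 3 ^ j * ((n.choose t : ℕ) : ℝ) * transferCoeff n t j s := by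
  have htj : t + j ≤ n := by omega
  have hco : transferCoeff n t j s = (((n - t - j).choose (s - t) : ℕ) : ℝ) / ((s.choose t : ℕ) : ℝ) := by
    rw [transferCoeff, if_pos hts, show ((n : ℝ) - t - j) = ((n - t - j : ℕ) : ℝ) by
      rw [Nat.sub_sub, Nat.cast_sub htj, Nat.cast_add]; ring, ← ff_natCast_div_factorial (n - t - j) (s - t)]
    rw [div_div]
  have hcs : (0 : ℝ) < ((s.choose t : ℕ) : ℝ) := by exact_mod_cast Nat.choose_pos hts
  rw [hco, mul_div_assoc', le_div_iff₀ hcs]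
  have key : n.choose s * s.choose t ≤ 3 ^ j * n.choose t * (n - t - j).choose (s - t) := by
    rw [Nat.choose_mul hts]
    have hpos : 0 < (n - t).choose j := Nat.choose_pos (by omega)
    refine Nat.le_of_mul_le_mul_right ?_ hpos
    have hid : (n - t).choose (s - t) * (n - s).choose j = (n - t).choose j * (n - t - j).choose (s - t) := by
      have e1 := Nat.choose_mul (n := n - t) (k := (s - t) + j) (s := s - t) (Nat.le_add_right _ j)
      have e2 := Nat.choose_mul (n := n - t) (k := (s - t) + j) (s := j) (Nat.le_add_left j _)
      rw [Nat.add_sub_cancel_left, Nat.choose_symm_add, show n - t - (s - t) = n - s by omega] at e1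
      rw [Nat.add_sub_cancel] at e2
      rw [← e1, ← e2]
    have h3 : (n - t).choose j ≤ 3 ^ j * (n - s).choose j :=
      calc (n - t).choose j ≤ (2 * (n - s)).choose j := Nat.choose_le_choose j (by omega)
        _ ≤ 3 ^ j * (n - s).choose j := choose_two_mul_le_three_pow_mul_choose (by omega)
    calc n.choose t * (n - t).choose (s - t) * (n - t).choose j
        ≤ n.choose t * (n - t).choose (s - t) * (3 ^ j * (n - s).choose j) := Nat.mul_le_mul_left _ h3
      _ = 3 ^ j * n.choose t * ((n - t).choose (s - t) * (n - s).choose j) := by ring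
      _ = 3 ^ j * n.choose t * ((n - t).choose j * (n - t - j).choose (s - t)) := by rw [hid]
      _ = 3 ^ j * n.choose t * (n - t - j).choose (s - t) * (n - t).choose j := by ring
  exact_mod_cast key

/-- **Lower bound for the transfer constant** (wide balance): for `100 ≤ n ≤ 5t`, `2t ≤ n`, `16j ≤ n`:
`2^n ≤ 4 · 3^j · C(n,t) · K`. [cite: ODonnell2014, §9.5] -/
theorem two_pow_le_transferConst_mul' {t j : ℕ} (hn : 100 ≤ n) (hbal : n ≤ 5 * t) (h2t : 2 * t ≤ n)
    (hj : 16 * j ≤ n) : (2 : ℝ) ^ n ≤ 4 * 3 ^ j * ((n.choose t : ℕ) : ℝ) * transferConst n t j := by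
  have htj : t + j ≤ n := by omega
  have hwin := two_pow_le_four_mul_sum_choose_window' hn
  have hle : ∑ s ∈ range (n + 1), (if n ≤ 2 * s ∧ 5 * s ≤ 3 * n then ((n.choose s : ℕ) : ℝ) else 0) ≤
      3 ^ j * ((n.choose t : ℕ) : ℝ) * transferConst n t j := by
    rw [transferConst, mul_sum]
    refine sum_le_sum fun s hs => ?_
    have hsn : s ≤ n := by have := mem_range.1 hs; omega
    split_ifs with h
    · exact choose_le_transferCoeff_mul' (by omega) hsn h.2 hbal hj
    · exact mul_nonneg (by positivity) (transferCoeff_nonneg htj s)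
  linarith

/-- **The slice-norm ratio** (wide balance): `3^j C(n,t) ≤ 64^j C(n−2j, t−j)` for `n ≤ 5t`, `2t ≤ n`, `16j ≤ n`.
[cite: ODonnell2014, §9.5] -/
theorem three_pow_mul_choose_le' {t j : ℕ} (hbal : n ≤ 5 * t) (h2t : 2 * t ≤ n) (hj : 16 * j ≤ n) :
    (3 : ℝ) ^ j * ((n.choose t : ℕ) : ℝ) ≤ 64 ^ j * (((n - 2 * j).choose (t - j) : ℕ) : ℝ) := by
  have hjt : j ≤ t := by omega
  have htj : t + j ≤ n := by omega
  have hid := choose_mul_descFactorial_mul_descFactorial hjt htj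
  have h1 : (n : ℝ) ^ j ≤ 8 ^ j * (t.descFactorial j : ℝ) := by
    have h := Nat.pow_sub_le_descFactorial t j
    have h' : ((t + 1 - j : ℕ) : ℝ) ^ j ≤ (t.descFactorial j : ℝ) := by exact_mod_cast h
    have h8 : (n : ℝ) ≤ 8 * ((t + 1 - j : ℕ) : ℝ) := by
      rw [Nat.cast_sub (by omega)]; push_cast
      have : (n : ℝ) ≤ 5 * t := by exact_mod_cast hbal
      have : 16 * (j : ℝ) ≤ n := by exact_mod_cast hj
      linarith
    calc (n : ℝ) ^ j ≤ (8 * ((t + 1 - j : ℕ) : ℝ)) ^ j := pow_le_pow_left₀ (Nat.cast_nonneg _) h8 j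
      _ = 8 ^ j * ((t + 1 - j : ℕ) : ℝ) ^ j := mul_pow _ _ _
      _ ≤ 8 ^ j * (t.descFactorial j : ℝ) := mul_le_mul_of_nonneg_left h' (by positivity)
  have h2 : (3 : ℝ) ^ j * (n : ℝ) ^ j ≤ 8 ^ j * ((n - t).descFactorial j : ℝ) := by
    have h := Nat.pow_sub_le_descFactorial (n - t) j
    have h' : ((n - t + 1 - j : ℕ) : ℝ) ^ j ≤ ((n - t).descFactorial j : ℝ) := by exact_mod_cast h
    have h8 : 3 * (n : ℝ) ≤ 8 * ((n - t + 1 - j : ℕ) : ℝ) := by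
      rw [Nat.cast_sub (by omega)]; push_cast; rw [Nat.cast_sub (by omega)]
      have : 2 * (t : ℝ) ≤ n := by exact_mod_cast h2t
      have : 16 * (j : ℝ) ≤ n := by exact_mod_cast hj
      linarith
    calc (3 : ℝ) ^ j * (n : ℝ) ^ j = (3 * (n : ℝ)) ^ j := (mul_pow _ _ _).symm
      _ ≤ (8 * ((n - t + 1 - j : ℕ) : ℝ)) ^ j := pow_le_pow_left₀ (by positivity) h8 j
      _ = 8 ^ j * ((n - t + 1 - j : ℕ) : ℝ) ^ j := mul_pow _ _ _
      _ ≤ 8 ^ j * ((n - t).descFactorial j : ℝ) := mul_le_mul_of_nonneg_left h' (by positivity)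
  have h3 : (n.descFactorial (2 * j) : ℝ) ≤ (n : ℝ) ^ (2 * j) := by exact_mod_cast Nat.descFactorial_le_pow n (2 * j)
  have hidR : ((n.choose t : ℕ) : ℝ) * (t.descFactorial j : ℝ) * ((n - t).descFactorial j : ℝ) =
      (((n - 2 * j).choose (t - j) : ℕ) : ℝ) * (n.descFactorial (2 * j) : ℝ) := by exact_mod_cast hid
  rcases Nat.eq_zero_or_pos n with hn0 | hnpos
  · subst hn0
    have : j = 0 := by omega
    subst this; simp
  have hnj : (0 : ℝ) < (n : ℝ) ^ (2 * j) := by positivity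
  refine le_of_mul_le_mul_right ?_ hnj
  calc (3 : ℝ) ^ j * ((n.choose t : ℕ) : ℝ) * (n : ℝ) ^ (2 * j)
      = ((n.choose t : ℕ) : ℝ) * ((n : ℝ) ^ j) * (3 ^ j * (n : ℝ) ^ j) := by rw [pow_mul']; ring
    _ ≤ ((n.choose t : ℕ) : ℝ) * (8 ^ j * (t.descFactorial j : ℝ)) * (8 ^ j * ((n - t).descFactorial j : ℝ)) := by
        gcongr
    _ = 64 ^ j * (((n.choose t : ℕ) : ℝ) * (t.descFactorial j : ℝ) * ((n - t).descFactorial j : ℝ)) := by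
        rw [show (64 : ℝ) ^ j = 8 ^ j * 8 ^ j by rw [← mul_pow]; norm_num]; ring
    _ = 64 ^ j * ((((n - 2 * j).choose (t - j) : ℕ) : ℝ) * (n.descFactorial (2 * j) : ℝ)) := by rw [hidR]
    _ ≤ 64 ^ j * ((((n - 2 * j).choose (t - j) : ℕ) : ℝ) * (n : ℝ) ^ (2 * j)) := by gcongr
    _ = 64 ^ j * (((n - 2 * j).choose (t - j) : ℕ) : ℝ) * (n : ℝ) ^ (2 * j) := by ring

/-- **The transfer factor** (wide balance): for `100 ≤ n ≤ 5t`, `2t ≤ n`, `16j ≤ n`, `Λ = transferLambda n t j ≤ 16 · 48^j · C(n,t)`.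
[cite: ODonnell2014, §9.5] -/
theorem transferLambda_le' {t j : ℕ} (hn : 100 ≤ n) (hbal : n ≤ 5 * t) (h2t : 2 * t ≤ n) (hj : 16 * j ≤ n) :
    transferLambda n t j ≤ 16 * 48 ^ j * ((n.choose t : ℕ) : ℝ) := by
  have hjt : j ≤ t := by omega
  have htj : t + j ≤ n := by omega
  set K := transferConst n t j with hK_def
  have hK : 0 < K := lt_of_lt_of_le zero_lt_one (one_le_transferConst htj)
  have hKlow := two_pow_le_transferConst_mul' hn hbal h2t hj
  have hratio := three_pow_mul_choose_le' (n := n) hbal h2t hj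
  have hct : (0 : ℝ) < ((n.choose t : ℕ) : ℝ) := by exact_mod_cast Nat.choose_pos (by omega)
  have hff : ff ((n : ℝ) - 2 * j) (t - j) = ((t - j).factorial : ℝ) * (((n - 2 * j).choose (t - j) : ℕ) : ℝ) := by
    rw [show ((n : ℝ) - 2 * j) = ((n - 2 * j : ℕ) : ℝ) by rw [Nat.cast_sub (by omega)]; push_cast; ring,
      ← ff_natCast_div_factorial]
    field_simp
  have hcpos : (0 : ℝ) < (((n - 2 * j).choose (t - j) : ℕ) : ℝ) := by
    exact_mod_cast Nat.choose_pos (by omega)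
  have hΛ : transferLambda n t j = (4 : ℝ) ^ (n - j) / (K ^ 2 * (((n - 2 * j).choose (t - j) : ℕ) : ℝ)) := by
    rw [transferLambda, ← hK_def, hff]
    field_simp
  rw [hΛ, div_le_iff₀ (by positivity)]
  have hsq : (4 : ℝ) ^ n ≤ (4 * 3 ^ j * ((n.choose t : ℕ) : ℝ) * K) ^ 2 := by
    rw [show (4 : ℝ) ^ n = (2 ^ n) ^ 2 by rw [← pow_mul, mul_comm, pow_mul]; norm_num]
    exact pow_le_pow_left₀ (by positivity) hKlow 2
  have h4 : (4 : ℝ) ^ (n - j) * 4 ^ j = 4 ^ n := by rw [← pow_add, Nat.sub_add_cancel (by omega)]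
  have h4j : (0 : ℝ) < 4 ^ j := by positivity
  refine le_of_mul_le_mul_right ?_ h4j
  rw [h4]
  calc (4 : ℝ) ^ n ≤ (4 * 3 ^ j * ((n.choose t : ℕ) : ℝ) * K) ^ 2 := hsq
    _ = 16 * ((n.choose t : ℕ) : ℝ) * K ^ 2 * (3 ^ j * (3 ^ j * ((n.choose t : ℕ) : ℝ))) := by ring
    _ ≤ 16 * ((n.choose t : ℕ) : ℝ) * K ^ 2 * (3 ^ j * (64 ^ j * (((n - 2 * j).choose (t - j) : ℕ) : ℝ))) := by
        gcongr
    _ = 16 * 48 ^ j * ((n.choose t : ℕ) : ℝ) * (K ^ 2 * (((n - 2 * j).choose (t - j) : ℕ) : ℝ)) * 4 ^ j := by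
        have e64 : (64 : ℝ) ^ j = 16 ^ j * 4 ^ j := by rw [← mul_pow]; norm_num
        have e48 : (48 : ℝ) ^ j = 3 ^ j * 16 ^ j := by rw [← mul_pow]; norm_num
        rw [e64, e48]; ring

/-- **The level-`j` inequality, wide balance** (`j ≥ 1`, `100 ≤ n ≤ 5t`, `2t ≤ n`, `16j ≤ n`): for `0 ≤ f ≤ 1` on the
`t`-sets with mean `μ` and every harmonic `q` of degree `j`,
`⟨f, zeta q⟩² ≤ 16 · C(n,t) · μ² · (48 e (2 ln(1/μ)/j + 3))^j · Σ_{|U|=t} (zeta q U)²`. [cite: ODonnell2014, §9.5] -/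
theorem slice_level_sq_le_log_balanced' {j t : ℕ} (hn : 100 ≤ n) (hbal : n ≤ 5 * t) (h2t : 2 * t ≤ n)
    (hj1 : 1 ≤ j) (hj : 16 * j ≤ n) {q : Finset (Fin n) → ℝ} (hq : IsHarmonic j q) (f : Finset (Fin n) → ℝ)
    (hf0 : ∀ U : Finset (Fin n), U.card = t → 0 ≤ f U) (hf1 : ∀ U : Finset (Fin n), U.card = t → f U ≤ 1) :
    (∑ U ∈ powersetCard t univ, f U * zeta q U) ^ 2 ≤
      16 * ((n.choose t : ℕ) : ℝ) * sliceMean n t f ^ 2 *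
        (48 * (Real.exp 1 * (2 * Real.log (1 / sliceMean n t f) / j + 3))) ^ j *
        ∑ U ∈ powersetCard t univ, zeta q U ^ 2 := by
  have hjt : j ≤ t := by omega
  have htj : t + j ≤ n := by omega
  have h := slice_level_sq_le_log hj1 hjt htj hq f hf0 hf1
  have hΛ := transferLambda_le' hn hbal h2t hj
  have hμ0 : 0 ≤ sliceMean n t f := sliceMean_nonneg hf0
  have hμ1 : sliceMean n t f ≤ 1 := sliceMean_le_one hf1
  have hL : 0 ≤ 2 * Real.log (1 / sliceMean n t f) / j + 3 := by
    rcases hμ0.eq_or_lt with hz | hpos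
    · rw [← hz]; simp
    · have : 0 ≤ Real.log (1 / sliceMean n t f) :=
        Real.log_nonneg (by rw [le_div_iff₀ hpos, one_mul]; exact hμ1)
      positivity
  calc (∑ U ∈ powersetCard t univ, f U * zeta q U) ^ 2
      ≤ transferLambda n t j * sliceMean n t f ^ 2 *
          (Real.exp 1 * (2 * Real.log (1 / sliceMean n t f) / j + 3)) ^ j *
          ∑ U ∈ powersetCard t univ, zeta q U ^ 2 := h
    _ ≤ (16 * 48 ^ j * ((n.choose t : ℕ) : ℝ)) * sliceMean n t f ^ 2 *
          (Real.exp 1 * (2 * Real.log (1 / sliceMean n t f) / j + 3)) ^ j *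
          ∑ U ∈ powersetCard t univ, zeta q U ^ 2 := by
        gcongr
    _ = 16 * ((n.choose t : ℕ) : ℝ) * sliceMean n t f ^ 2 *
        (48 * (Real.exp 1 * (2 * Real.log (1 / sliceMean n t f) / j + 3))) ^ j *
        ∑ U ∈ powersetCard t univ, zeta q U ^ 2 := by
        rw [mul_pow (48 : ℝ)]; ring

/-- **Projection form, wide balance**: for `100 ≤ n ≤ 5t`, `2t ≤ n`, `1 ≤ j`, `16j ≤ n`, `0 ≤ f ≤ 1` on the `t`-sets with
mean `μ` and harmonic layers `f = Σ_{i≤t} zeta p_i` there: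
`Σ_{|U|=t} (zeta p_j U)² ≤ 16 · C(n,t) · μ² · (48 e (2 ln(1/μ)/j + 3))^j`. [cite: ODonnell2014, §9.5] -/
theorem slice_layer_sq_le_log_balanced' {j t : ℕ} (hn : 100 ≤ n) (hbal : n ≤ 5 * t) (h2t : 2 * t ≤ n)
    (hj1 : 1 ≤ j) (hj : 16 * j ≤ n) (p : ℕ → Finset (Fin n) → ℝ) (hp : ∀ i, IsHarmonic i (p i))
    (f : Finset (Fin n) → ℝ) (hf0 : ∀ U : Finset (Fin n), U.card = t → 0 ≤ f U)
    (hf1 : ∀ U : Finset (Fin n), U.card = t → f U ≤ 1)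
    (hdec : ∀ U ∈ powersetCard t (univ : Finset (Fin n)), f U = ∑ i ∈ range (t + 1), zeta (p i) U) :
    ∑ U ∈ powersetCard t univ, zeta (p j) U ^ 2 ≤
      16 * ((n.choose t : ℕ) : ℝ) * sliceMean n t f ^ 2 *
        (48 * (Real.exp 1 * (2 * Real.log (1 / sliceMean n t f) / j + 3))) ^ j := by
  have hjt : j ≤ t := by omega
  have htj : t + j ≤ n := by omega
  have h := slice_layer_sq_le_log hj1 hjt htj p hp f hf0 hf1 hdec
  have hΛ := transferLambda_le' hn hbal h2t hj
  have hμ0 : 0 ≤ sliceMean n t f := sliceMean_nonneg hf0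
  have hμ1 : sliceMean n t f ≤ 1 := sliceMean_le_one hf1
  have hL : 0 ≤ 2 * Real.log (1 / sliceMean n t f) / j + 3 := by
    rcases hμ0.eq_or_lt with hz | hpos
    · rw [← hz]; simp
    · have : 0 ≤ Real.log (1 / sliceMean n t f) :=
        Real.log_nonneg (by rw [le_div_iff₀ hpos, one_mul]; exact hμ1)
      positivity
  calc ∑ U ∈ powersetCard t univ, zeta (p j) U ^ 2
      ≤ transferLambda n t j * sliceMean n t f ^ 2 *
          (Real.exp 1 * (2 * Real.log (1 / sliceMean n t f) / j + 3)) ^ j := h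
    _ ≤ (16 * 48 ^ j * ((n.choose t : ℕ) : ℝ)) * sliceMean n t f ^ 2 *
          (Real.exp 1 * (2 * Real.log (1 / sliceMean n t f) / j + 3)) ^ j := by gcongr
    _ = 16 * ((n.choose t : ℕ) : ℝ) * sliceMean n t f ^ 2 *
        (48 * (Real.exp 1 * (2 * Real.log (1 / sliceMean n t f) / j + 3))) ^ j := by
        rw [mul_pow (48 : ℝ)]; ring

end SliceLevelInequality

end Literature.Combinatorics.AssociationSchemes
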